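import Literature.Barriers.CriticalPhenomena.PlaquetteWalkHoleRootMiddleTurnColumn
import Literature.Barriers.CriticalPhenomena.PlaquetteWalkHoleRootFirstTurn
import HarnessLib

/-!
# Barrier catalogue (SAWScalingLimit): the FORCED FRAME of a cost-`5` wound class-`B2a` walk whose first turn is isolated — the walk is rigid and
kiss-free up to its fifth isolated turn («FORCED FRAME»)

`Z → ∞` limit model of the printed Yang–Baxter weights [GlazmanManolescu2019, §1, eq. (1)]; the «RECTANGLE COEFFICIENT» line. Inputs:
`PlaquetteWalkHoleRootNoVerticalEnd` (slanted end), `PlaquetteWalkHoleRootMiddleTurnColumn` (the middle isolated turn lies in an extreme column; THE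
SEGMENT LEMMA), `PlaquetteWalkHoleRootFirstTurn` / `…InitialRun` (the initial straight run along the hole row), #824 (run shapes).

★★★ `ΩG.forced_frame_of_isolated_first_turn`. Let `ω` be a wound class-`B2a` walk of limit cost `5` from the hole root `w.side W` whose FIRST TURN (arc `k₁`,
all earlier arcs straight) lies in a singly visited plaquette. Then the first turn is the middle isolated turn `τ* = (X', w.2)` at the east end of the
initial run, in the RIGHTMOST column, and the walk is FORCED up to an index `t > k₁`: every arc `i ≤ t` is straight or one of the five
isolated turns (τ*, the two ends of the top run, the two ends of the bottom run — all of index `≤ t`), every plaquette visited up to `t` is visited exactly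
once, the arc `t` is the fifth isolated turn and leaves vertically from an extreme row, and EVERY turning arc after `t` lies in a doubly visited
plaquette. (Rising first turn: τ* → straight up the rightmost column → top-right corner → top run westwards → top-left corner → straight down the leftmost
column → bottom-left corner → bottom run eastwards → its exit `t`, leaving `N`. Falling first turn: the mirror order, `t` = the top run's exit, leaving `S`.)

Use (venture lane «pcv-sawmu», b-engine-1 g25; DESIGN-next-g25 §2/§2bis): this is CASE B of (R2) «no doubly visited plaquette» up to the TAIL; the remaining
input is the KISS-LOOP LEMMA (a tail that may only turn at doubly visited plaquettes cannot return onto a plaquette first hit in the head), a Jordan /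
winding-number argument in the style of `PlaquetteWalkHoleRootPrefixLoop`. Census kit j276221: the classes 'as'/'ao'/'ac' (tail = the straight final run).
[GlazmanManolescu2019 §1 Fig. 1, eq. (1), Lemma 2.1, Remark 2.2; Glazman 2015 Lemma 3.1 (proof, pp. 6–7)]
-/

noncomputable section

namespace Literature.Probability.RandomPlanarGeometry.SAW.YangBaxter

open Real
open Literature.Barriers.CriticalPhenomena.PlaquetteWalk

open private fc_fh fc_ne fh_add_Mv three_le_Mv from Literature.Probability.RandomPlanarGeometry.YangBaxterSAWGeneralDomain

namespace YBWalk

variable {D : Set Face} {a z : MidEdge} (γ : YBWalk D a z)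

/-- ★ **A STRAIGHT ARC IS ALONE IN ITS PLAQUETTE**: if the arc `i` is straight, no other arc lies in `fc i` (two arcs of one rhombus are the two corner
arcs or the two co-corner arcs). [cite: GlazmanManolescu2019, §1, Fig. 1 (the configurations `w₁`, `w₂`)] -/
theorem single_visit_of_straight {i : ℕ} (hi : i < γ.arcs.length) (hk : arcKind (γ.sIn i) (γ.sOut i) = .straight) :
    ∀ j < γ.arcs.length, γ.fc j = γ.fc i → j = i := by
  intro j hj he
  by_contra hne
  have := (γ.not_straight_of_two_arcs hi hj (Ne.symm hne) he).1
  exact this (γ.sOut_of_straight hi hk)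

end YBWalk

namespace ΩG

variable {D : Set Face} {w r : Face} {ω : ΩG D (w.side .W) r}

/-- Six pairwise distinct isolated-turn plaquettes are too many at limit cost `5` (`n_{u₁} + n_{u₂} = 5`).
[cite: GlazmanManolescu2019, §1, Fig. 1 and eq. (1); Lemma 2.1; Remark 2.2] -/
theorem no_sixth_isolated_turn (hh : holeFaceW w ∉ D) (hr : RootedFace D (w.side .W) r) (h : ω.IsB2a)
    (hA : ω.AJ hr h (toC (midPt (w.side .W))) ≠ 0) (hc : cost (slotOfSide ω.1) ω.2.mids = 5) (T : Finset Face)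
    (hT : ∀ f ∈ T, f ∈ facesL ω.2.mids ∧ (kindsL ω.2.mids f = [.corner] ∨ kindsL ω.2.mids f = [.coCorner])) : T.card ≤ 5 := by
  have h5 := (isolated_eq_five_of_cost_five hh hr h hA hc).1
  have := YBWalk.card_le_cfgCount_add ω.2.mids T hT
  omega

/-- ★★★ **THE FORCED FRAME OF A COST-`5` WOUND WALK WITH AN ISOLATED FIRST TURN.** Let `ω` be a wound class-`B2a` walk of limit cost `5` from the hole root
`w.side W` (hole `(w.1 − 1, w.2)` absent), `k₁` its first turning arc (all earlier arcs straight), and suppose the plaquette of the arc `k₁` is visited once.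
Then there is an index `t > k₁` such that: (i) the first turn lies at `(X', w.2)` in the rightmost column `X' = w.1 + k₁`; (ii) every arc
`i ≤ t` is straight or an isolated turn, and every plaquette `fc i`, `i ≤ t`, is visited exactly once; (iii) the arc `t` is a turn leaving through `N` from
the bottom row or through `S` from the top row; (iv) every TURNING arc after `t` lies in a DOUBLY visited plaquette (all five isolated turns are spent by `t`).
[cite: GlazmanManolescu2019, §1, Fig. 1 and eq. (1); Lemma 2.1; Remark 2.2] [cite: Glazman2015WeightedSAW, Lemma 3.1 (proof, pp. 6–7)] -/
theorem forced_frame_of_isolated_first_turn (hh : holeFaceW w ∉ D) (hr : RootedFace D (w.side .W) r) (h : ω.IsB2a)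
    (hA : ω.AJ hr h (toC (midPt (w.side .W))) ≠ 0) (hc : cost (slotOfSide ω.1) ω.2.mids = 5) {k₁ : ℕ} (hk₁ : k₁ < ω.2.arcs.length)
    (hstr : ∀ i < k₁, arcKind (ω.2.sIn i) (ω.2.sOut i) = .straight) (hturn : arcKind (ω.2.sIn k₁) (ω.2.sOut k₁) ≠ .straight)
    (hsv₁ : ∀ j < ω.2.arcs.length, ω.2.fc j = ω.2.fc k₁ → j = k₁) :
    ∃ t : ℕ, k₁ < t ∧ t < ω.2.arcs.length ∧
      (∃ X' Y Y' : ℤ, w.1 ≤ X' ∧ Y' < w.2 ∧ w.2 < Y ∧ (∀ j < ω.2.arcs.length, (ω.2.fc j).1 ≤ X' ∧ Y' ≤ (ω.2.fc j).2 ∧ (ω.2.fc j).2 ≤ Y) ∧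
        ω.2.fc k₁ = (X', w.2) ∧
        (((ω.2.fc t).2 = Y' ∧ ω.2.sOut t = .N) ∨ ((ω.2.fc t).2 = Y ∧ ω.2.sOut t = .S))) ∧
      (∀ i ≤ t, ∀ j < ω.2.arcs.length, ω.2.fc j = ω.2.fc i → j = i) ∧
      arcKind (ω.2.sIn t) (ω.2.sOut t) ≠ .straight ∧
      (∀ i, t < i → i < ω.2.arcs.length → arcKind (ω.2.sIn i) (ω.2.sOut i) ≠ .straight →
        ∃ j < ω.2.arcs.length, j ≠ i ∧ ω.2.fc j = ω.2.fc i) := by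
  classical
  have hz := end_slanted_of_cost_five hh hr h hA hc
  have hd : slotDeg (slotOfSide ω.1) = 1 := by rcases hz with e | e <;> rw [e] <;> rfl
  -- the profile (extreme rows, card bounds) and the frame columns
  obtain ⟨Y, Y', hY'w, hYw, hY, hY', hprof, -⟩ := turn_profile_of_cost_five hh hr h hA hc
  obtain ⟨Yg, Yg', X, X', hYg'w, hYgw, hXw, hX'w, hbd, -, -, hmidcol⟩ := middle_turn_in_extreme_column hh hr h hA hc
  have hX : ∀ j < ω.2.arcs.length, X ≤ (ω.2.fc j).1 := fun j hj => (hbd j hj).2.2.1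
  have hX' : ∀ j < ω.2.arcs.length, (ω.2.fc j).1 ≤ X' := fun j hj => (hbd j hj).2.2.2
  have hYY : Y' < Y := by omega
  -- single visits of the extreme rows/columns
  have hsvL : ∀ i j, i < ω.2.arcs.length → j < ω.2.arcs.length → (ω.2.fc i).1 = X → ω.2.fc i = ω.2.fc j → i = j :=
    fun i j hi hj hcol he => left_single_visit hh hr h hX (by omega) hi hj hcol he
  have hsvR : ∀ i j, i < ω.2.arcs.length → j < ω.2.arcs.length → (ω.2.fc i).1 = X' → ω.2.fc i = ω.2.fc j → i = j :=
    fun i j hi hj hcol he => right_single_visit hh hr h hX' hi hj hcol he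
  have hsvT : ∀ i j, i < ω.2.arcs.length → j < ω.2.arcs.length → (ω.2.fc i).2 = Y → ω.2.fc i = ω.2.fc j → i = j :=
    fun i j hi hj hrow he => top_single_visit hh hr h hY hYw hi hj hrow he
  have hsvB : ∀ i j, i < ω.2.arcs.length → j < ω.2.arcs.length → (ω.2.fc i).2 = Y' → ω.2.fc i = ω.2.fc j → i = j :=
    fun i j hi hj hrow he => bottom_single_visit hh hr h hY' hY'w hi hj hrow he
  have hsvsL : ∀ i, i < ω.2.arcs.length → (ω.2.fc i).1 = X → ∀ j < ω.2.arcs.length, ω.2.fc j = ω.2.fc i → j = i :=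
    fun i hi hcol j hj he => (hsvL i j hi hj hcol he.symm).symm
  have hsvsR : ∀ i, i < ω.2.arcs.length → (ω.2.fc i).1 = X' → ∀ j < ω.2.arcs.length, ω.2.fc j = ω.2.fc i → j = i :=
    fun i hi hcol j hj he => (hsvR i j hi hj hcol he.symm).symm
  -- the first turn: at `(w.1 + k₁, w.2)`, entering from `W`, isolated, in the middle row ⇒ rightmost column
  obtain ⟨hrun, -⟩ := ω.2.initial_run hh hk₁ hstr
  obtain ⟨hfk, hWk⟩ := hrun k₁ le_rfl
  obtain ⟨hmemk, hkindk⟩ := isolated_turn hk₁ hsv₁ hturn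
  have hcolk : (ω.2.fc k₁).1 = X' := by
    rcases hmidcol _ hmemk hkindk (by rw [hfk]; exact hYg'w) (by rw [hfk]; exact hYgw) with e | e
    · exfalso; rw [hfk] at e; simp only at e; omega
    · exact e
  have hX'eq : X' = w.1 + k₁ := by rw [hfk] at hcolk; simpa using hcolk.symm
  have hrowk : (ω.2.fc k₁).2 = w.2 := by rw [hfk]
  have hfirstR : ∀ j < k₁, (ω.2.fc j).1 ≠ X' := by
    intro j hj e; rw [(hrun j hj.le).1] at e; simp only at e; omega
  have houtk : ω.2.sOut k₁ = .N ∨ ω.2.sOut k₁ = .S := by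
    have hne := ω.2.sIn_ne_sOut hk₁
    have hE := (forall_right_ne_E hh hr h hX' k₁ hk₁ hcolk).2
    rw [hWk] at hne
    revert hne hE; cases ω.2.sOut k₁ <;> decide
  -- an isolated turn other than `τ* = fc k₁` lies in an extreme row (the profile allows ONE middle isolated turn)
  have hmid : ∀ i < ω.2.arcs.length, (∀ j < ω.2.arcs.length, ω.2.fc j = ω.2.fc i → j = i) →
      arcKind (ω.2.sIn i) (ω.2.sOut i) ≠ .straight → ω.2.fc i ≠ ω.2.fc k₁ → (ω.2.fc i).2 = Y ∨ (ω.2.fc i).2 = Y' := by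
    intro i hi hsv hk hne'
    obtain ⟨hmem, hkind⟩ := isolated_turn hi hsv hk
    by_contra hrow
    push Not at hrow
    have hlt : Y' < (ω.2.fc i).2 ∧ (ω.2.fc i).2 < Y :=
      ⟨lt_of_le_of_ne (hY' i hi) (fun e => hrow.2 e.symm), lt_of_le_of_ne (hY i hi) hrow.1⟩
    have := (hprof {ω.2.fc k₁, ω.2.fc i} (fun g hg => by
      simp only [Finset.mem_insert, Finset.mem_singleton] at hg
      rcases hg with rfl | rfl
      · exact ⟨hmemk, hkindk⟩
      · exact ⟨hmem, hkind⟩)).2.2 (fun g hg => by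
      simp only [Finset.mem_insert, Finset.mem_singleton] at hg
      rcases hg with rfl | rfl
      · exact ⟨by rw [hrowk]; exact hY'w, by rw [hrowk]; exact hYw⟩
      · exact hlt)
    rw [Finset.card_insert_of_notMem (by simpa using hne'.symm), Finset.card_singleton, hd] at this
    omega
  have hisoL : ∀ i < ω.2.arcs.length, (ω.2.fc i).1 = X → arcKind (ω.2.sIn i) (ω.2.sOut i) ≠ .straight →
      (ω.2.fc i).2 = Y ∨ (ω.2.fc i).2 = Y' :=
    fun i hi hcol hk => hmid i hi (hsvsL i hi hcol) hk (fun e => by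
      have := congrArg Prod.fst e; rw [hcol, hcolk] at this; omega)
  -- the left column `X₁ ≤ w.1 − 2` (attained): its turning arcs lie in the extreme rows, so it is one segment between the corners
  obtain ⟨X₁, hX₁w, hX₁, sL, -, hsL, hcolL, hfirstL, hinL, houtL⟩ := exists_left_entry_turn hh hr h hA
  have hsvL : ∀ i j, i < ω.2.arcs.length → j < ω.2.arcs.length → (ω.2.fc i).1 = X₁ → ω.2.fc i = ω.2.fc j → i = j :=
    fun i j hi hj hcol he => left_single_visit hh hr h hX₁ (by omega) hi hj hcol he
  have hsvsL : ∀ i, i < ω.2.arcs.length → (ω.2.fc i).1 = X₁ → ∀ j < ω.2.arcs.length, ω.2.fc j = ω.2.fc i → j = i :=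
    fun i hi hcol j hj he => (hsvL i j hi hj hcol he.symm).symm
  have hisoL : ∀ i < ω.2.arcs.length, (ω.2.fc i).1 = X₁ → arcKind (ω.2.sIn i) (ω.2.sOut i) ≠ .straight →
      (ω.2.fc i).2 = Y ∨ (ω.2.fc i).2 = Y' :=
    fun i hi hcol hk => hmid i hi (hsvsL i hi hcol) hk (fun e => by
      have := congrArg Prod.fst e; rw [hcol, hcolk] at this; omega)
  obtain ⟨eL, hlL, heL, hiffL, hWE_L, hneWL, -, hsegL⟩ := extreme_column_segment hr h hz (σ := .W) (Or.inl rfl) hY hY'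
    (forall_left_ne_W hh hr h hX₁ (by omega)) hsvL hisoL hsL hcolL hfirstL (Or.inr hinL) houtL
  have houtEL : ω.2.sOut eL = .E := by
    rcases hWE_L with h' | h'
    · exact absurd h' hneWL
    · exact h'
  have hcolEL : (ω.2.fc eL).1 = X₁ := (hiffL eL (by omega)).2 ⟨hlL.le, le_rfl⟩
  -- the raw segment of the rightmost column from the first turn
  obtain ⟨e₁, hke₁, he₁, hend₁, hseg₁, hmono₁⟩ := column_segment_raw hk₁ hcolk houtk
  have hnl₁ := segment_not_last hr h hz he₁ hke₁ hfirstR hseg₁ hmono₁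
  have he₁1 : e₁ + 1 < ω.2.arcs.length := by omega
  have hend₁' : (ω.2.fc (e₁ + 1)).1 ≠ X' := by rcases hend₁ with h' | h' <;> [omega; exact h']
  -- the segment leaves through `W` (not `E`, not vertically), after a vertical entry; so `k₁ < e₁`
  have houtW₁ : ω.2.sOut e₁ = .W := by
    have hnv : ¬(ω.2.sOut e₁ = .S ∨ ω.2.sOut e₁ = .N) := fun hSN => hend₁' (by
      rw [ω.2.fc_succ_col_of_sOut_SN he₁1 hSN]; exact hseg₁ e₁ hke₁ le_rfl)
    have hnE := (forall_right_ne_E hh hr h hX' e₁ he₁ (hseg₁ e₁ hke₁ le_rfl)).2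
    revert hnv hnE; cases ω.2.sOut e₁ <;> simp
  have hlt₁ : k₁ < e₁ := by
    rcases Nat.eq_or_lt_of_le hke₁ with hes | hlt
    · exfalso; rw [← hes] at houtW₁; rcases houtk with o | o <;> rw [o] at houtW₁ <;> exact absurd houtW₁ (by decide)
    · exact hlt
  have hin₁ : ω.2.sIn e₁ = .S ∨ ω.2.sIn e₁ = .N := by
    have := ω.2.sIn_SN_of_col_eq (i := e₁ - 1) (by omega) (by
      rw [show e₁ - 1 + 1 = e₁ by omega, hseg₁ e₁ hke₁ le_rfl, hseg₁ (e₁ - 1) (by omega) (by omega)])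
    rwa [show e₁ - 1 + 1 = e₁ by omega] at this
  have hke₁' : arcKind (ω.2.sIn e₁) (ω.2.sOut e₁) ≠ .straight := by
    rcases hin₁ with i' | i' <;> rw [i', houtW₁] <;> decide
  have hcole₁ : (ω.2.fc e₁).1 = X' := hseg₁ e₁ hke₁ le_rfl
  have hrow_e₁ := hmid e₁ he₁ (hsvsR e₁ he₁ hcole₁) hke₁' (fun e => by have := hsv₁ e₁ he₁ e; omega)
  -- the top and bottom runs
  obtain ⟨Yt, -, hYt, j₀, i₁, hj₀1, hji, hi₁, hrowT, hinT, houtT0, houtT, hinT', hstrT, hmarchT⟩ :=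
    top_run_shape hh hr h hA (by omega)
  obtain ⟨Yb, -, hYb, j₀', i₁', hj₀1', hji', hi₁', hrowB, hinB, houtB0, houtB, hinB', hstrB, hmarchB⟩ :=
    bottom_run_shape hh hr h hA (by omega)
  have eYt : Yt = Y := by
    refine le_antisymm ?_ ?_
    · have := hY j₀ (by omega); rw [(hrowT j₀ (by omega)).2 ⟨le_rfl, hji.le⟩] at this; exact this
    · rcases hsegL with ⟨-, hre, -⟩ | ⟨hrs, -⟩
      · have := hYt eL (by omega); rw [hre] at this; exact this
      · have := hYt sL hsL; rw [hrs] at this; exact this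
  have eYb : Yb = Y' := by
    refine le_antisymm ?_ ?_
    · rcases hsegL with ⟨hrs, -⟩ | ⟨-, hre, -⟩
      · have := hYb sL hsL; rw [hrs] at this; exact this
      · have := hYb eL (by omega); rw [hre] at this; exact this
    · have := hY' j₀' (by omega); rw [(hrowB j₀' (by omega)).2 ⟨le_rfl, hji'.le⟩] at this; exact this
  subst eYt; subst eYb
  -- uniqueness of the vertical entries/exits of the runs
  have honlyT_in : ∀ m < ω.2.arcs.length, (ω.2.fc m).2 = Yt → (ω.2.sIn m = .S ∨ ω.2.sIn m = .N) → m = j₀ := by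
    intro m hm hrow hSN
    obtain ⟨h1, h2⟩ := (hrowT m hm).1 hrow
    by_contra hne'
    rcases lt_or_eq_of_le h2 with hlt' | rfl
    · have hk := hstrT m (by omega) hlt'
      rcases hmarchT with ⟨hWall, -⟩ | ⟨hEall, -⟩
      · rw [hWall m h1 hlt'] at hk; rcases hSN with e | e <;> rw [e] at hk <;> exact absurd hk (by decide)
      · rw [hEall m h1 hlt'] at hk; rcases hSN with e | e <;> rw [e] at hk <;> exact absurd hk (by decide)
    · rcases hinT' with e | e <;> rcases hSN with e' | e' <;> rw [e] at e' <;> exact absurd e' (by decide)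
  have honlyT_out : ∀ m < ω.2.arcs.length, (ω.2.fc m).2 = Yt → (ω.2.sOut m = .S ∨ ω.2.sOut m = .N) → m = i₁ := by
    intro m hm hrow hSN
    obtain ⟨h1, h2⟩ := (hrowT m hm).1 hrow
    by_contra hne'
    have hlt' : m < i₁ := lt_of_le_of_ne h2 hne'
    rcases hmarchT with ⟨hWall, -⟩ | ⟨hEall, -⟩
    · have := hWall m h1 hlt'; rcases hSN with e | e <;> rw [this] at e <;> exact absurd e (by decide)
    · have := hEall m h1 hlt'; rcases hSN with e | e <;> rw [this] at e <;> exact absurd e (by decide)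
  have honlyB_in : ∀ m < ω.2.arcs.length, (ω.2.fc m).2 = Yb → (ω.2.sIn m = .S ∨ ω.2.sIn m = .N) → m = j₀' := by
    intro m hm hrow hSN
    obtain ⟨h1, h2⟩ := (hrowB m hm).1 hrow
    by_contra hne'
    rcases lt_or_eq_of_le h2 with hlt' | rfl
    · have hk := hstrB m (by omega) hlt'
      rcases hmarchB with ⟨hWall, -⟩ | ⟨hEall, -⟩
      · rw [hWall m h1 hlt'] at hk; rcases hSN with e | e <;> rw [e] at hk <;> exact absurd hk (by decide)
      · rw [hEall m h1 hlt'] at hk; rcases hSN with e | e <;> rw [e] at hk <;> exact absurd hk (by decide)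
    · rcases hinB' with e | e <;> rcases hSN with e' | e' <;> rw [e] at e' <;> exact absurd e' (by decide)
  have honlyB_out : ∀ m < ω.2.arcs.length, (ω.2.fc m).2 = Yb → (ω.2.sOut m = .S ∨ ω.2.sOut m = .N) → m = i₁' := by
    intro m hm hrow hSN
    obtain ⟨h1, h2⟩ := (hrowB m hm).1 hrow
    by_contra hne'
    have hlt' : m < i₁' := lt_of_le_of_ne h2 hne'
    rcases hmarchB with ⟨hWall, -⟩ | ⟨hEall, -⟩
    · have := hWall m h1 hlt'; rcases hSN with e | e <;> rw [this] at e <;> exact absurd e (by decide)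
    · have := hEall m h1 hlt'; rcases hSN with e | e <;> rw [this] at e <;> exact absurd e (by decide)
  have hinI₁_of_W : (∀ m, j₀ ≤ m → m < i₁ → ω.2.sOut m = .W) → ω.2.sIn i₁ = .E := fun hWall => by
    have := (ω.2.fc_succ_eq_of_sOut_W (show i₁ - 1 + 1 < ω.2.arcs.length by omega) (hWall (i₁ - 1) (by omega) (by omega))).2
    rwa [show i₁ - 1 + 1 = i₁ by omega] at this
  have hinI₁'_of_E : (∀ m, j₀' ≤ m → m < i₁' → ω.2.sOut m = .E) → ω.2.sIn i₁' = .W := fun hEall => by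
    have := (ω.2.fc_succ_eq_of_sOut_E (show i₁' - 1 + 1 < ω.2.arcs.length by omega) (hEall (i₁' - 1) (by omega) (by omega))).2
    rwa [show i₁' - 1 + 1 = i₁' by omega] at this
  have hinI₁'_of_W : (∀ m, j₀' ≤ m → m < i₁' → ω.2.sOut m = .W) → ω.2.sIn i₁' = .E := fun hWall => by
    have := (ω.2.fc_succ_eq_of_sOut_W (show i₁' - 1 + 1 < ω.2.arcs.length by omega) (hWall (i₁' - 1) (by omega) (by omega))).2
    rwa [show i₁' - 1 + 1 = i₁' by omega] at this
  have hinI₁_of_E : (∀ m, j₀ ≤ m → m < i₁ → ω.2.sOut m = .E) → ω.2.sIn i₁ = .W := fun hEall => by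
    have := (ω.2.fc_succ_eq_of_sOut_E (show i₁ - 1 + 1 < ω.2.arcs.length by omega) (hEall (i₁ - 1) (by omega) (by omega))).2
    rwa [show i₁ - 1 + 1 = i₁ by omega] at this
  -- straightness inside the right segment: for `k₁ < m < e₁` the arc `m` enters and leaves vertically
  have hstr₁ : ∀ m, k₁ < m → m < e₁ → arcKind (ω.2.sIn m) (ω.2.sOut m) = .straight := by
    intro m h1 h2
    have hout : ω.2.sOut m = .N ∨ ω.2.sOut m = .S := by
      rcases hmono₁ with ⟨-, hall, -⟩ | ⟨-, hall, -⟩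
      · exact Or.inl (hall m h1.le h2)
      · exact Or.inr (hall m h1.le h2)
    have hin : ω.2.sIn m = .S ∨ ω.2.sIn m = .N := by
      have := ω.2.sIn_SN_of_col_eq (i := m - 1) (by omega) (by
        rw [show m - 1 + 1 = m by omega, hseg₁ m h1.le h2.le, hseg₁ (m - 1) (by omega) (by omega)])
      rwa [show m - 1 + 1 = m by omega] at this
    have hne := ω.2.sIn_ne_sOut (show m < ω.2.arcs.length by omega)
    revert hin hout hne; cases ω.2.sIn m <;> cases ω.2.sOut m <;> simp (config := { decide := true })
  -- straightness inside the left segment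
  have hstrL : ∀ m, sL < m → m < eL → arcKind (ω.2.sIn m) (ω.2.sOut m) = .straight := by
    intro m h1 h2
    by_contra hk
    have hm : m < ω.2.arcs.length := by omega
    have hcolm : (ω.2.fc m).1 = X₁ := (hiffL m hm).2 ⟨h1.le, h2.le⟩
    -- a turn inside the segment is isolated, in an extreme row; but the segment's interior rows are strictly between
    have hrow := hisoL m hm hcolm hk
    rcases hsegL with ⟨hrs, hre, -, -, hpos⟩ | ⟨hrs, hre, -, -, hpos⟩
    · have e := hpos (m - sL) (by omega); rw [show sL + (m - sL) = m by omega] at e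
      have e2 := hpos (eL - sL) (by omega); rw [show sL + (eL - sL) = eL by omega] at e2
      have := congrArg Prod.snd e; have := congrArg Prod.snd e2; simp only at *; omega
    · have e := hpos (m - sL) (by omega); rw [show sL + (m - sL) = m by omega] at e
      have e2 := hpos (eL - sL) (by omega); rw [show sL + (eL - sL) = eL by omega] at e2
      have := congrArg Prod.snd e; have := congrArg Prod.snd e2; simp only at *; omega
  -- CASE ANALYSIS on the direction of the first turn
  rcases hmono₁ with ⟨hNk, -, hpos₁⟩ | ⟨hSk, -, hpos₁⟩
  · ---------------- RISING first turn: the right segment climbs to the top-right corner `e₁ = j₀`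
    have hre₁ : (ω.2.fc e₁).2 = Yt := by
      rcases hrow_e₁ with h' | h'
      · exact h'
      · exfalso
        have e := hpos₁ (e₁ - k₁) (by omega); rw [show k₁ + (e₁ - k₁) = e₁ by omega] at e
        have := congrArg Prod.snd e; simp only at this; omega
    have hinS₁ : ω.2.sIn e₁ = .S := by
      rcases hin₁ with i' | i'
      · exact i'
      · exfalso
        have hprev := hpos₁ (e₁ - 1 - k₁) (by omega); rw [show k₁ + (e₁ - 1 - k₁) = e₁ - 1 by omega] at hprev
        have e2 := hpos₁ (e₁ - k₁) (by omega); rw [show k₁ + (e₁ - k₁) = e₁ by omega] at e2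
        have := ω.2.fc_pred_eq_of_sIn_N he₁ (by omega) i'
        rw [hprev, e2] at this; simp only [Prod.mk.injEq] at this; omega
    have hj₀ : e₁ = j₀ := honlyT_in e₁ he₁ hre₁ (Or.inl hinS₁)
    -- the top run marches WEST from column `X'`
    rcases hmarchT with ⟨hWall, hlenT⟩ | ⟨hEall, hlenT⟩
    swap
    · exfalso; have := hX' i₁ hi₁; rw [← hj₀, hcole₁] at hlenT; omega
    have hinI₁ := hinI₁_of_W hWall
    -- its west end `i₁` (entering `E`, leaving `S`) is the left segment's start `sL`; the left segment descends
    -- the corner `(X₁, Yt)` is visited by the left segment (one of its ends); it lies in the top row, hence in `[j₀, i₁]`, so the top run reaches column `X₁`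
    have hXi₁ : (ω.2.fc i₁).1 = X₁ := by
      -- the row-`Yt` end of the left segment
      have hcolT : ∃ m, m < ω.2.arcs.length ∧ (ω.2.fc m).1 = X₁ ∧ (ω.2.fc m).2 = Yt := by
        rcases hsegL with ⟨-, hre, -⟩ | ⟨hrs, -⟩
        · exact ⟨eL, by omega, hcolEL, hre⟩
        · exact ⟨sL, hsL, hcolL, hrs⟩
      obtain ⟨m, hm, hcm, hrm⟩ := hcolT
      obtain ⟨h1, h2⟩ := (hrowT m hm).1 hrm
      have e2 : (ω.2.fc i₁).1 + ((i₁ - j₀ : ℕ) : ℤ) = (ω.2.fc j₀).1 := hlenT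
      -- columns along the westward run decrease: column(m) = column(j₀) − (m − j₀) ≥ column(i₁)
      have hcols := fun k (hk : j₀ + k ≤ i₁) =>
        (ω.2.run_W (i := j₀) (hWall j₀ le_rfl hji) k (by omega)
          (fun k' h1' h2' => by rw [(hrowT k' (by omega)).2 ⟨h1', by omega⟩, (hrowT j₀ (by omega)).2 ⟨le_rfl, hji.le⟩])).2
      have em := hcols (m - j₀) (by omega); rw [show j₀ + (m - j₀) = m by omega, hcm] at em
      have ei := hcols (i₁ - j₀) (by omega); rw [show j₀ + (i₁ - j₀) = i₁ by omega] at ei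
      have := hX₁ i₁ hi₁
      omega
    have hi₁sL : i₁ = sL := by
      obtain ⟨h1, h2⟩ := (hiffL i₁ hi₁).1 hXi₁
      -- an arc of the left segment entering horizontally is its first arc
      by_contra hne'
      have hlt' : sL < i₁ := lt_of_le_of_ne h1 (Ne.symm hne')
      have := ω.2.sIn_SN_of_col_eq (i := i₁ - 1) (by omega) (by
        rw [show i₁ - 1 + 1 = i₁ by omega, hXi₁]; exact ((hiffL (i₁ - 1) (by omega)).2 ⟨by omega, by omega⟩).symm)
      rw [show i₁ - 1 + 1 = i₁ by omega, hinI₁] at this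
      rcases this with e | e <;> exact absurd e (by decide)
    -- so the left segment descends: `sL` at row `Yt`, `eL` at row `Yb`, entering `N`, leaving `E` ⇒ `eL = j₀'`
    rcases hsegL with ⟨hrs, -, hNsL, -, -⟩ | ⟨hrs, hre, hSsL, hNeL, -⟩
    · exfalso; rw [← hi₁sL, houtT] at hNsL; exact absurd hNsL (by decide)
    have hj₀' : eL = j₀' := honlyB_in eL (by omega) hre (Or.inr hNeL)
    -- the bottom run marches EAST from column `X₁`
    rcases hmarchB with ⟨hWallB, hlenB⟩ | ⟨hEallB, hlenB⟩
    · exfalso; have := hX₁ i₁' hi₁'; rw [← hj₀', hcolEL] at hlenB; omega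
    have hinI₁' := hinI₁'_of_E hEallB
    -- t := i₁' : the bottom run's exit, leaving `N`
    refine ⟨i₁', by omega, hi₁', ⟨X', Yt, Yb, hX'w, hY'w, hYw, fun j hj => ⟨hX' j hj, hY' j hj, hY j hj⟩, by rw [hfk, hX'eq],
      Or.inl ⟨(hrowB i₁' hi₁').2 ⟨hji'.le, le_rfl⟩, houtB⟩⟩, ?_, ?_, ?_⟩
    · -- (ii) every plaquette up to `t = i₁'` is visited once: its arc is straight, or it is one of the five isolated turns
      intro i hi j hj he
      by_cases hk : arcKind (ω.2.sIn i) (ω.2.sOut i) = .straight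
      · exact ω.2.single_visit_of_straight (by omega) hk j hj he
      · -- a turning arc `≤ t` is one of `k₁, e₁ = j₀, i₁ = sL, eL = j₀', i₁'`
        have hcases : i = k₁ ∨ i = e₁ ∨ i = i₁ ∨ i = eL ∨ i = i₁' := by
          by_contra hnone
          push Not at hnone
          obtain ⟨h1, h2, h3, h4, h5⟩ := hnone
          rcases lt_or_gt_of_ne h1 with hlt | hgt
          · exact hk (hstr i hlt)
          rcases lt_or_gt_of_ne h2 with hlt2 | hgt2
          · exact hk (hstr₁ i hgt hlt2)
          rcases lt_or_gt_of_ne h3 with hlt3 | hgt3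
          · exact hk (hstrT i (by omega) hlt3)
          rcases lt_or_gt_of_ne h4 with hlt4 | hgt4
          · exact hk (hstrL i (by omega) hlt4)
          rcases lt_or_gt_of_ne h5 with hlt5 | hgt5
          · exact hk (hstrB i (by omega) hlt5)
          · omega
        rcases hcases with h' | h' | h' | h' | h' <;> rw [h'] at he ⊢
        · exact hsv₁ j hj he
        · exact hsvsR e₁ he₁ hcole₁ j hj he
        · rw [hi₁sL] at he ⊢; exact hsvsL sL hsL hcolL j hj he
        · exact hsvsL eL (by omega) hcolEL j hj he
        · exact (hsvB i₁' j hi₁' hj ((hrowB i₁' hi₁').2 ⟨hji'.le, le_rfl⟩) he.symm).symm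
    · -- (iii) the arc `t` turns (`W → N`)
      rw [hinI₁', houtB]; decide
    · -- (iv) a turning arc after `t` lies in a doubly visited plaquette: otherwise it would be a SIXTH isolated turn
      intro i hti hi hk
      by_contra hnone
      push Not at hnone
      have hsv : ∀ j < ω.2.arcs.length, ω.2.fc j = ω.2.fc i → j = i := fun j hj he => by
        by_contra hne; exact hnone j hj hne he
      obtain ⟨hmemi, hkindi⟩ := isolated_turn hi hsv hk
      obtain ⟨hmem₁, hkind₁⟩ := isolated_turn he₁ (hsvsR e₁ he₁ hcole₁) hke₁'
      obtain ⟨hmemL, hkindL⟩ := isolated_turn hsL (hsvsL sL hsL hcolL) (by rw [hinL]; rcases houtL with e | e <;> rw [e] <;> decide)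
      obtain ⟨hmemE, hkindE⟩ := isolated_turn (show eL < ω.2.arcs.length by omega) (hsvsL eL (by omega) hcolEL)
        (by rw [hNeL, houtEL]; decide)
      obtain ⟨hmemB, hkindB⟩ := isolated_turn hi₁' (fun j hj he => (hsvB i₁' j hi₁' hj ((hrowB i₁' hi₁').2 ⟨hji'.le, le_rfl⟩) he.symm).symm)
        (by rw [hinI₁', houtB]; decide)
      -- the six indices are pairwise distinct and `fc` is injective on them
      let I : Finset ℕ := {k₁, e₁, sL, eL, i₁', i}
      have hIcard : I.card = 6 := by
        simp only [I]
        rw [Finset.card_insert_of_notMem (by simp; omega), Finset.card_insert_of_notMem (by simp; omega),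
          Finset.card_insert_of_notMem (by simp; omega), Finset.card_insert_of_notMem (by simp; omega),
          Finset.card_insert_of_notMem (by simp; omega), Finset.card_singleton]
      have hinj : Set.InjOn (fun m => ω.2.fc m) (I : Set ℕ) := by
        intro a ha b hb hab
        simp only [I, Finset.coe_insert, Finset.coe_singleton, Set.mem_insert_iff, Set.mem_singleton_iff] at ha hb
        -- each of the six plaquettes is singly visited
        have hsva : ∀ j < ω.2.arcs.length, ω.2.fc j = ω.2.fc a → j = a := by
          rcases ha with h'' | h'' | h'' | h'' | h'' | h'' <;> rw [h'']
          · exact hsv₁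
          · exact hsvsR e₁ he₁ hcole₁
          · exact hsvsL sL hsL hcolL
          · exact hsvsL eL (by omega) hcolEL
          · exact fun j hj he => (hsvB i₁' j hi₁' hj ((hrowB i₁' hi₁').2 ⟨hji'.le, le_rfl⟩) he.symm).symm
          · exact hsv
        have hb' : b < ω.2.arcs.length := by rcases hb with h'' | h'' | h'' | h'' | h'' | h'' <;> rw [h''] <;> omega
        exact (hsva b hb' hab.symm).symm
      have hcard := Finset.card_image_of_injOn hinj
      have h6 := no_sixth_isolated_turn hh hr h hA hc (I.image fun m => ω.2.fc m) (fun f hf => by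
        obtain ⟨m, hm, rfl⟩ := Finset.mem_image.1 hf
        simp only [I, Finset.mem_insert, Finset.mem_singleton] at hm
        rcases hm with h'' | h'' | h'' | h'' | h'' | h'' <;> rw [h'']
        · exact ⟨hmemk, hkindk⟩
        · exact ⟨hmem₁, hkind₁⟩
        · exact ⟨hmemL, hkindL⟩
        · exact ⟨hmemE, hkindE⟩
        · exact ⟨hmemB, hkindB⟩
        · exact ⟨hmemi, hkindi⟩)
      rw [hcard, hIcard] at h6
      omega
  · ---------------- FALLING first turn (mirror: the right segment descends to the bottom-right corner `e₁ = j₀'`)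
    have hre₁ : (ω.2.fc e₁).2 = Yb := by
      rcases hrow_e₁ with h' | h'
      · exfalso
        have e := hpos₁ (e₁ - k₁) (by omega); rw [show k₁ + (e₁ - k₁) = e₁ by omega] at e
        have := congrArg Prod.snd e; simp only at this; omega
      · exact h'
    have hinN₁ : ω.2.sIn e₁ = .N := by
      rcases hin₁ with i' | i'
      · exfalso
        have hprev := hpos₁ (e₁ - 1 - k₁) (by omega); rw [show k₁ + (e₁ - 1 - k₁) = e₁ - 1 by omega] at hprev
        have e2 := hpos₁ (e₁ - k₁) (by omega); rw [show k₁ + (e₁ - k₁) = e₁ by omega] at e2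
        have := ω.2.fc_pred_eq_of_sIn_S he₁ (by omega) i'
        rw [hprev, e2] at this; simp only [Prod.mk.injEq] at this; omega
      · exact i'
    have hj₀' : e₁ = j₀' := honlyB_in e₁ he₁ hre₁ (Or.inr hinN₁)
    -- the bottom run marches WEST from column `X'`
    rcases hmarchB with ⟨hWallB, hlenB⟩ | ⟨hEallB, hlenB⟩
    swap
    · exfalso; have := hX' i₁' hi₁'; rw [← hj₀', hcole₁] at hlenB; omega
    have hinI₁' := hinI₁'_of_W hWallB
    -- its west end `i₁'` (entering `E`, leaving `N`) is the left segment's start `sL`; the left segment climbs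
    have hXi₁' : (ω.2.fc i₁').1 = X₁ := by
      have hcolB : ∃ m, m < ω.2.arcs.length ∧ (ω.2.fc m).1 = X₁ ∧ (ω.2.fc m).2 = Yb := by
        rcases hsegL with ⟨hrs, -⟩ | ⟨-, hre, -⟩
        · exact ⟨sL, hsL, hcolL, hrs⟩
        · exact ⟨eL, by omega, hcolEL, hre⟩
      obtain ⟨m, hm, hcm, hrm⟩ := hcolB
      obtain ⟨h1, h2⟩ := (hrowB m hm).1 hrm
      have hcols := fun k (hk : j₀' + k ≤ i₁') =>
        (ω.2.run_W (i := j₀') (hWallB j₀' le_rfl hji') k (by omega)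
          (fun k' h1' h2' => by rw [(hrowB k' (by omega)).2 ⟨h1', by omega⟩, (hrowB j₀' (by omega)).2 ⟨le_rfl, hji'.le⟩])).2
      have em := hcols (m - j₀') (by omega); rw [show j₀' + (m - j₀') = m by omega, hcm] at em
      have ei := hcols (i₁' - j₀') (by omega); rw [show j₀' + (i₁' - j₀') = i₁' by omega] at ei
      have := hX₁ i₁' hi₁'
      omega
    have hi₁sL : i₁' = sL := by
      obtain ⟨h1, h2⟩ := (hiffL i₁' hi₁').1 hXi₁'
      by_contra hne'
      have hlt' : sL < i₁' := lt_of_le_of_ne h1 (Ne.symm hne')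
      have := ω.2.sIn_SN_of_col_eq (i := i₁' - 1) (by omega) (by
        rw [show i₁' - 1 + 1 = i₁' by omega, hXi₁']; exact ((hiffL (i₁' - 1) (by omega)).2 ⟨by omega, by omega⟩).symm)
      rw [show i₁' - 1 + 1 = i₁' by omega, hinI₁'] at this
      rcases this with e | e <;> exact absurd e (by decide)
    -- so the left segment climbs: `sL` at row `Yb`, `eL` at row `Yt`, entering `S`, leaving `E` ⇒ `eL = j₀`
    rcases hsegL with ⟨hrs, hre, hNsL, hSeL, -⟩ | ⟨hrs, -, hSsL, -, -⟩
    swap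
    · exfalso; rw [← hi₁sL, houtB] at hSsL; exact absurd hSsL (by decide)
    have hj₀ : eL = j₀ := honlyT_in eL (by omega) hre (Or.inl hSeL)
    -- the top run marches EAST from column `X₁`
    rcases hmarchT with ⟨hWall, hlenT⟩ | ⟨hEall, hlenT⟩
    · exfalso; have := hX₁ i₁ hi₁; rw [← hj₀, hcolEL] at hlenT; omega
    have hinI₁ := hinI₁_of_E hEall
    -- t := i₁ : the top run's exit, leaving `S`
    refine ⟨i₁, by omega, hi₁, ⟨X', Yt, Yb, hX'w, hY'w, hYw, fun j hj => ⟨hX' j hj, hY' j hj, hY j hj⟩, by rw [hfk, hX'eq],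
      Or.inr ⟨(hrowT i₁ hi₁).2 ⟨hji.le, le_rfl⟩, houtT⟩⟩, ?_, ?_, ?_⟩
    · intro i hi j hj he
      by_cases hk : arcKind (ω.2.sIn i) (ω.2.sOut i) = .straight
      · exact ω.2.single_visit_of_straight (by omega) hk j hj he
      · have hcases : i = k₁ ∨ i = e₁ ∨ i = i₁' ∨ i = eL ∨ i = i₁ := by
          by_contra hnone
          push Not at hnone
          obtain ⟨h1, h2, h3, h4, h5⟩ := hnone
          rcases lt_or_gt_of_ne h1 with hlt | hgt
          · exact hk (hstr i hlt)
          rcases lt_or_gt_of_ne h2 with hlt2 | hgt2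
          · exact hk (hstr₁ i hgt hlt2)
          rcases lt_or_gt_of_ne h3 with hlt3 | hgt3
          · exact hk (hstrB i (by omega) hlt3)
          rcases lt_or_gt_of_ne h4 with hlt4 | hgt4
          · exact hk (hstrL i (by omega) hlt4)
          rcases lt_or_gt_of_ne h5 with hlt5 | hgt5
          · exact hk (hstrT i (by omega) hlt5)
          · omega
        rcases hcases with h' | h' | h' | h' | h' <;> rw [h'] at he ⊢
        · exact hsv₁ j hj he
        · exact hsvsR e₁ he₁ hcole₁ j hj he
        · rw [hi₁sL] at he ⊢; exact hsvsL sL hsL hcolL j hj he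
        · exact hsvsL eL (by omega) hcolEL j hj he
        · exact (hsvT i₁ j hi₁ hj ((hrowT i₁ hi₁).2 ⟨hji.le, le_rfl⟩) he.symm).symm
    · rw [hinI₁, houtT]; decide
    · intro i hti hi hk
      by_contra hnone
      push Not at hnone
      have hsv : ∀ j < ω.2.arcs.length, ω.2.fc j = ω.2.fc i → j = i := fun j hj he => by
        by_contra hne; exact hnone j hj hne he
      obtain ⟨hmemi, hkindi⟩ := isolated_turn hi hsv hk
      obtain ⟨hmem₁, hkind₁⟩ := isolated_turn he₁ (hsvsR e₁ he₁ hcole₁) hke₁'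
      obtain ⟨hmemL, hkindL⟩ := isolated_turn hsL (hsvsL sL hsL hcolL) (by rw [hinL]; rcases houtL with e | e <;> rw [e] <;> decide)
      obtain ⟨hmemE, hkindE⟩ := isolated_turn (show eL < ω.2.arcs.length by omega) (hsvsL eL (by omega) hcolEL)
        (by rw [hSeL, houtEL]; decide)
      obtain ⟨hmemT, hkindT⟩ := isolated_turn hi₁ (fun j hj he => (hsvT i₁ j hi₁ hj ((hrowT i₁ hi₁).2 ⟨hji.le, le_rfl⟩) he.symm).symm)
        (by rw [hinI₁, houtT]; decide)
      let I : Finset ℕ := {k₁, e₁, sL, eL, i₁, i}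
      have hIcard : I.card = 6 := by
        simp only [I]
        rw [Finset.card_insert_of_notMem (by simp; omega), Finset.card_insert_of_notMem (by simp; omega),
          Finset.card_insert_of_notMem (by simp; omega), Finset.card_insert_of_notMem (by simp; omega),
          Finset.card_insert_of_notMem (by simp; omega), Finset.card_singleton]
      have hinj : Set.InjOn (fun m => ω.2.fc m) (I : Set ℕ) := by
        intro a ha b hb hab
        simp only [I, Finset.coe_insert, Finset.coe_singleton, Set.mem_insert_iff, Set.mem_singleton_iff] at ha hb
        have hsva : ∀ j < ω.2.arcs.length, ω.2.fc j = ω.2.fc a → j = a := by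
          rcases ha with h'' | h'' | h'' | h'' | h'' | h'' <;> rw [h'']
          · exact hsv₁
          · exact hsvsR e₁ he₁ hcole₁
          · exact hsvsL sL hsL hcolL
          · exact hsvsL eL (by omega) hcolEL
          · exact fun j hj he => (hsvT i₁ j hi₁ hj ((hrowT i₁ hi₁).2 ⟨hji.le, le_rfl⟩) he.symm).symm
          · exact hsv
        have hb' : b < ω.2.arcs.length := by rcases hb with h'' | h'' | h'' | h'' | h'' | h'' <;> rw [h''] <;> omega
        exact (hsva b hb' hab.symm).symm
      have hcard := Finset.card_image_of_injOn hinj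
      have h6 := no_sixth_isolated_turn hh hr h hA hc (I.image fun m => ω.2.fc m) (fun f hf => by
        obtain ⟨m, hm, rfl⟩ := Finset.mem_image.1 hf
        simp only [I, Finset.mem_insert, Finset.mem_singleton] at hm
        rcases hm with h'' | h'' | h'' | h'' | h'' | h'' <;> rw [h'']
        · exact ⟨hmemk, hkindk⟩
        · exact ⟨hmem₁, hkind₁⟩
        · exact ⟨hmemL, hkindL⟩
        · exact ⟨hmemE, hkindE⟩
        · exact ⟨hmemT, hkindT⟩
        · exact ⟨hmemi, hkindi⟩)
      rw [hcard, hIcard] at h6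
      omega

end ΩG

end Literature.Probability.RandomPlanarGeometry.SAW.YangBaxter
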